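import Summits.HodgeConjecture.CorCM.GaloisThirtyTwoCaseADegenerate
import Summits.HodgeConjecture.CorCM.GaloisThirtyTwoCentralSquares
import Summits.HodgeConjecture.CorCM.GaloisThirtyTwoOrderSixteenBranch
import Summits.HodgeConjecture.CorCM.GaloisTwoPowerStructuredHodge
import HarnessLib

/-!
# The `2`-power classification is unconditional: STRUCT(32), hence GOOD ⟺ `Gal ∈ {C, Q, C × C₂, Q × C₂}` in every degree `2ⁿ ≥ 32`

COR-CM (cell `pub-hodgecm2`), binder seat b04 (gen 37), count-neutral own lane «Galois-CM-type classification».  KERNEL ONLY: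
theorems; no definition, no named fact, no `sorry`.  `HC_CM` is neither used nor claimed.  THE ORDER-`32` BASE IS CLOSED
(A7-JUNCTION gens 34–37): for a Galois CM field `K` of degree `32` all of whose primitive CM types are nondegenerate («GOOD»),
`Gal(K/ℚ) = H·E` with `E` central of exponent `2`, `|E| ≤ 2`, `c ∈ H ∖ E`, `H` cyclic or generalised quaternion («STRUCT»):
by `struct_thirtytwo_of_minimal_case` (`CorCM/GaloisThirtyTwoCentralSquares`) it suffices to treat the minimal fields (`c` the only
central involution), which are structured when `c` is the only involution (`struct_of_involution_unique`), when some automorphism has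
order `16` (`struct_of_orderOf_sixteen`), when `Gal` is abelian (`struct_of_comm_thirtytwo`), and otherwise BAD — all squares in
`{1, c}` (`exists_simple_degenerate_of_sq_subset`) or case A (`exists_simple_degenerate_of_caseA`).  With gen 35's induction
(`CorCM/GaloisTwoPowerClassification`): for every Galois CM field `K` of degree `2ⁿ`, `n ≥ 5`, GOOD ⟺ STRUCT, i.e.
`Gal(K/ℚ) ∈ {C_{2ⁿ}, Q_{2ⁿ}, C_{2ⁿ⁻¹} × C₂ (c ∈ C), Q_{2ⁿ⁻¹} × C₂ (c ∈ Q)}`; then every `σ` with `σ⁴ = 1` has `σ² ∈ {1, c}`, and the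
Hodge conjecture holds for every power of every abelian variety with CM by `K` (`hodgeConjectureFor_pow_of_two_power`).

## References

* [Shimura1998] G. Shimura, *Abelian Varieties with Complex Multiplication and Modular Functions*, §6.2 Thm. 3, §8.2 Prop. 26, §18.2.
* [Gordon1999HodgeAVSurvey] B. B. Gordon, *A survey of the Hodge conjecture for abelian varieties*, Thm. 6.4, §9.3, §9.4.3.
* [Rotman1995] J. J. Rotman, *An Introduction to the Theory of Groups*, 4th ed., GTM 148, Thm. 4.3, Cor. 5.45, Thm. 5.46.
* [Kubota1965] T. Kubota, *On the field extension by complex multiplication*, Trans. AMS 118 (1965), §2 and §4 Lemma 2.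
* [Dodson1984] B. Dodson, *The structure of Galois groups of CM-fields*, Trans. AMS 283 (1984), §3.3 and §5.2.
-/

noncomputable section

open CategoryTheory CategoryTheory.Limits NumberField
open scoped BigOperators

namespace Summit.HodgeConjecture.CorCM.GaloisModels

open Literature.NumberTheory.ComplexMultiplication
open Literature.AlgebraicGeometry.Motives (AbelianVariety CMType)
open Literature.AlgebraicGeometry.HodgeTheory
open Literature.AlgebraicGeometry.ComplexMultiplication (IsCMTypeRealisation)
open Literature.AlgebraicGeometry.Pohlmann1968
open Summit.HodgeConjecture.CorCM.GaloisRank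

/-! ## §1 The order-`32` base -/

section Field

variable {K : Type} [Field K] [NumberField K] [IsCMField K] [IsGalois ℚ K]

/-- **STRUCT(32).**  Every Galois CM field `K` of degree `32` all of whose primitive CM types are nondegenerate has
`Gal(K/ℚ) = H·E` (`H.IsComplement' E`) with `E` central of exponent `2`, `|E| ≤ 2`, `c ∈ H ∖ E`, and `H` cyclic or generalised
quaternion — i.e. `Gal(K/ℚ) ∈ {C₃₂, Q₃₂, C₁₆ × C₂ (c ∈ C₁₆), Q₁₆ × C₂ (c ∈ Q₁₆)}`. [cite: Shimura1998, §6.2 Thm. 3 and §8.2 Prop. 26]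
[cite: Gordon1999HodgeAVSurvey, Thm. 6.4 and §9.3] [cite: Rotman1995, Thm. 4.3, Cor. 5.45 and Thm. 5.46] [cite: Dodson1984, §3.3 and §5.2] -/
theorem struct_thirtytwo (hdeg : Module.finrank ℚ K = 32)
    (hgood : ∀ (Φ : CMType K) (φ : K →+* ℂ), IsPrimitive (ℂ ≃+* ℂ) Φ.1 φ → IsNondegenerate Φ) :
    ∃ (H E : Subgroup (K ≃ₐ[ℚ] K)) (k : ℕ), H.IsComplement' E ∧ (IsCMField.complexConj K).restrictScalars ℚ ∈ H ∧
      (IsCMField.complexConj K).restrictScalars ℚ ∉ E ∧ (∀ e ∈ E, e * e = 1 ∧ ∀ g : K ≃ₐ[ℚ] K, g * e = e * g) ∧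
      Nat.card E ≤ 2 ∧ Nat.card H = 2 ^ k ∧ (IsCyclic H ∨ (3 ≤ k ∧ Nonempty (H ≃* QuaternionGroup (2 ^ (k - 2))))) := by
  classical
  refine struct_thirtytwo_of_minimal_case hdeg hgood fun hmin => ?_
  set c := (IsCMField.complexConj K).restrictScalars ℚ with hcdef
  -- `c` the unique involution
  by_cases huniq : ∀ s : K ≃ₐ[ℚ] K, s * s = 1 → s ≠ 1 → s = c
  · exact struct_of_involution_unique (n := 5) (by rw [hdeg]; norm_num) huniq
  push Not at huniq
  obtain ⟨s, hss, hs1, hsc⟩ := huniq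
  -- an automorphism of order `16`
  by_cases h16 : ∃ a : K ≃ₐ[ℚ] K, orderOf a = 16
  · obtain ⟨a, ha⟩ := h16
    exact struct_of_orderOf_sixteen hdeg hgood a ha
  push Not at h16
  -- abelian
  by_cases hab : ∀ g h : K ≃ₐ[ℚ] K, g * h = h * g
  · exact struct_of_comm_thirtytwo hdeg hgood hab
  push Not at hab
  exfalso
  -- all squares in `{1, c}`: BAD
  by_cases hsq : ∀ g : K ≃ₐ[ℚ] K, g * g = 1 ∨ g * g = c
  · obtain ⟨Φ, φ, X, ι, ϑ, H1, H2, -⟩ := exists_simple_degenerate_of_sq_subset hdeg hsq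
    exact H2 (hgood Φ φ H1)
  push Not at hsq
  -- case A: BAD
  obtain ⟨Φ, φ, X, ι, ϑ, H1, H2, -⟩ := exists_simple_degenerate_of_caseA hdeg hmin ⟨s, hss, hs1, hsc⟩ h16 hab hsq
  exact H2 (hgood Φ φ H1)

/-! ## §2 The `2`-power classification, unconditionally -/

/-- **THE `2`-POWER CLASSIFICATION.**  For every Galois CM field `K` of degree `2ⁿ`, `n ≥ 5`: all primitive CM types of `K` are
nondegenerate (the Hodge ring of every power of every simple abelian variety with CM by `K` is generated by divisor classes) **iff**
`Gal(K/ℚ) = H·E` with `H.IsComplement' E`, `E` central of exponent `2`, `|E| ≤ 2`, `c ∈ H ∖ E`, `H` cyclic or generalised quaternion,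
i.e. iff `Gal(K/ℚ)` is `C_{2ⁿ}`, `Q_{2ⁿ}`, `C_{2ⁿ⁻¹} × C₂` (`c ∈ C`) or `Q_{2ⁿ⁻¹} × C₂` (`c ∈ Q`). [cite: Rotman1995, Thm. 5.46]
[cite: Kubota1965, §2 and §4 Lemma 2] [cite: Shimura1998, §8.2 Prop. 26 and §18.2] [cite: Gordon1999HodgeAVSurvey, §9.3 and §9.4.3] -/
theorem good_iff_struct_two_power {n : ℕ} (hdeg : Module.finrank ℚ K = 2 ^ n) (hn : 5 ≤ n) :
    (∀ (Φ : CMType K) (φ : K →+* ℂ), IsPrimitive (ℂ ≃+* ℂ) Φ.1 φ → IsNondegenerate Φ) ↔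
      ∃ (H E : Subgroup (K ≃ₐ[ℚ] K)) (k : ℕ), H.IsComplement' E ∧ (IsCMField.complexConj K).restrictScalars ℚ ∈ H ∧
        (IsCMField.complexConj K).restrictScalars ℚ ∉ E ∧ (∀ e ∈ E, e * e = 1 ∧ ∀ g : K ≃ₐ[ℚ] K, g * e = e * g) ∧
        Nat.card E ≤ 2 ∧ Nat.card H = 2 ^ k ∧ (IsCyclic H ∨ (3 ≤ k ∧ Nonempty (H ≃* QuaternionGroup (2 ^ (k - 2))))) :=
  good_iff_struct_of_degree_thirtytwo (fun _ _ _ _ _ hd hg => struct_thirtytwo hd hg) hdeg hn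

/-- **GOOD ⟹ STRUCT in every degree `2ⁿ ≥ 32`.** [cite: Rotman1995, Thm. 5.46] [cite: Shimura1998, §8.2 Prop. 26 and §18.2] -/
theorem struct_two_power {n : ℕ} (hdeg : Module.finrank ℚ K = 2 ^ n) (hn : 5 ≤ n)
    (hgood : ∀ (Φ : CMType K) (φ : K →+* ℂ), IsPrimitive (ℂ ≃+* ℂ) Φ.1 φ → IsNondegenerate Φ) :
    ∃ (H E : Subgroup (K ≃ₐ[ℚ] K)) (k : ℕ), H.IsComplement' E ∧ (IsCMField.complexConj K).restrictScalars ℚ ∈ H ∧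
      (IsCMField.complexConj K).restrictScalars ℚ ∉ E ∧ (∀ e ∈ E, e * e = 1 ∧ ∀ g : K ≃ₐ[ℚ] K, g * e = e * g) ∧
      Nat.card E ≤ 2 ∧ Nat.card H = 2 ^ k ∧ (IsCyclic H ∨ (3 ≤ k ∧ Nonempty (H ≃* QuaternionGroup (2 ^ (k - 2))))) :=
  struct_of_degree_thirtytwo (fun _ _ _ _ _ hd hg => struct_thirtytwo hd hg) hdeg hn hgood

/-- **(H2) in every degree `2ⁿ ≥ 64`**: in a GOOD Galois CM field of degree `2ⁿ`, `n ≥ 6`, every automorphism `σ` with `σ⁴ = 1` has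
`σ² ∈ {1, c}`. [cite: Shimura1998, §8.2 Prop. 26 and §32.10] [cite: Kubota1965, §2 and §4 Lemma 2] -/
theorem pow_four_sq_two_power {n : ℕ} (hdeg : Module.finrank ℚ K = 2 ^ n) (hn : 6 ≤ n)
    (hgood : ∀ (Φ : CMType K) (φ : K →+* ℂ), IsPrimitive (ℂ ≃+* ℂ) Φ.1 φ → IsNondegenerate Φ) (σ : K ≃ₐ[ℚ] K)
    (hσ : σ ^ 4 = 1) : σ * σ = 1 ∨ σ * σ = (IsCMField.complexConj K).restrictScalars ℚ :=
  pow_four_sq_of_degree_thirtytwo (fun _ _ _ _ _ hd hg => struct_thirtytwo hd hg) hdeg hn hgood σ hσ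

/-- **The Hodge conjecture for every power of every abelian variety with CM by a GOOD Galois CM field of `2`-power degree `≥ 32`**
(any CM type `Φ` of `K`, any realisation `A`, any power `⨁_{Fin N} A`). [cite: Gordon1999HodgeAVSurvey, Thm. 6.4, §9.3 and §9.4.3]
[cite: Shimura1998, §5.1 Prop. 3 and §8.2 Prop. 26] [cite: Rotman1995, Thm. 5.46] -/
theorem hodgeConjectureFor_pow_of_two_power {n : ℕ} (hdeg : Module.finrank ℚ K = 2 ^ n) (hn : 5 ≤ n)
    (hgood : ∀ (Φ : CMType K) (φ : K →+* ℂ), IsPrimitive (ℂ ≃+* ℂ) Φ.1 φ → IsNondegenerate Φ)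
    {Φ : CMType K} {A : AbelianVariety ℂ} {ι : 𝓞 K →+* End A} {θ : K →+* Module.End ℂ (complexBetti A.X 1)}
    (hA : IsCMTypeRealisation Φ A ι θ) (N : ℕ) :
    HodgeConjectureFor (⨁ fun _ : Fin N => A).dim (⨁ fun _ : Fin N => A).X :=
  hodgeConjectureFor_pow_of_degree_thirtytwo (fun _ _ _ _ _ hd hg => struct_thirtytwo hd hg) hdeg hn hgood hA N

end Field

end Summit.HodgeConjecture.CorCM.GaloisModels

end
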